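import Summits.BirchSwinnertonDyer.BirchSwinnertonDyer.Theorems.SignedLowerHalvesKobayashiLowerHalfLargeImageKuriharaRigidityThreeOfFacts
import Summits.BirchSwinnertonDyer.BirchSwinnertonDyer.Theorems.SignedLowerHalvesKobayashiLowerHalfLargeImageKuriharaRigidityThreeEngine
import Summits.BirchSwinnertonDyer.BirchSwinnertonDyer.Theorems.SignedLowerHalvesKobayashiLowerHalfLargeImageKuriharaRigidityBindersOfFacts
import HarnessLib

/-!
# Crux `KobayashiLowerHalfLargeImage` (item stmt-BirchSwinnertonDyer-19001), line `kurihara_rigidity`: the lead gen 2's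
# crux-by-name composition WITH the `p = 3` road (`kobayashiLowerHalfLargeImage_of_readings_of_kks_OPEN`, p614706)
# restated on the FINER named inputs — every composite binder replaced by its package-level statement, Kobayashi
# Thm 7.4 IN THE KERNEL at every odd `p` (cell `bsd-ssimc`, seat `bsd-line-slh-p1-w2` g2; `--supports … --as helper`)

WHAT. The lead's `kobayashiLowerHalfLargeImage_of_readings_of_kks_OPEN` (`…KuriharaRigidityThreeEngine`) gives the
crux BY NAME modulo {`Kim2026_thm111_via_kobayashi74`, `CastellaSano2026_thm1_via_kobayashi74_OPEN`,
`CastellaSano2026_sec2_tamagawaDefectGe_implicit_OPEN`, `realPeriodRat_eq_unit_mul_plusPeriod`,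
`KimKimSun2020_thm11_via_kobayashi74_three`, `realPeriodRat_eq_unit_mul_plusPeriod_three`} + the line's OPEN statements
{the `≤` half of Kim's Conjecture 1.10 on X7 ∧ ¬CM ∧ Surj ∧ `p ≥ 5`; Kurihara's [C] at `3` on the rows X7@3 ∧ ¬CM ∧
Surj ∧ (Tam)₁ ∧ `3 ∤ ∏ c_ℓ`; the crux at the other X7@3 pairs}. Three of the six named inputs are COMPOSITES «… ∘
Kobayashi 7.4». THIS FILE feeds them from this seat's derivations — `kim2026_thm111_via_kobayashi74_of_facts` (g0,
p608428), `castellaSano2026_thm1_via_kobayashi74_OPEN_of_facts` (g0, p608428), `kimKimSun2020_thm11_via_kobayashi74_three_of_facts`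
(g2, `…ThreeOfFacts`) — so that the crux BY NAME is stated modulo PACKAGE-LEVEL statements only:
{Kim 2026 Thm 1.11 (1) ⟹ (3) on the `η = 1` package [PUB], Castella–Sano Thm 1 (i) ⟹ (ii) on the package [PRE],
the lead's CS §2 `≥` reading [PRE], KKS Thm 1.1 at 3 on the package [claim-grade, flag `KKS20@3-MR-H4`, pen ruling
R-X8 D34-1 (b)], Kobayashi Thm 1.2 [PUB], the period facts at `p ≥ 5` / `p = 3` [PUB]} + the same three OPEN
statements. Kobayashi Thm 7.4 is a kernel step everywhere (`…Thm74` g0 at `p ≥ 5`, `…Thm74Odd` lead g2 at odd `p`).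

HONEST FRAMING (cell `bsd-ssimc`, D-0036/D-0074): TOOL THEOREM ONLY — no definition, no named fact minted, no `sorry`,
axioms standard; CONDITIONAL on the displayed named facts / claims and on the three OPEN statements; the crux, its
stubs and the route are NOT closed; nothing is booked; BSD is not proved by any of this.
`--supports stmt-BirchSwinnertonDyer-19001 --as helper`.

References: [Kim2022StructureSelmer] Thm 1.11, Conj 1.10; [CastellaSano2026] Thm 1, §2; [KimKimSun2020] Thm 1.1,
(Tam); [Kobayashi2003] Thm 1.2, Thm 7.4; [GreenbergVatsal2000] §3 Rem 3.4; [Mazur1978] Cor 4.1.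
-/

set_option autoImplicit false
-- single-problem summit (D-0017): the doubled namespace component is by design
set_option linter.dupNamespace false

noncomputable section

open scoped Classical MatrixGroups ModularForm

open CongruenceSubgroup Field WeierstrassCurve Literature.NumberTheory.EllipticCurves
  Literature.NumberTheory.EllipticCurves.ModularForms Literature.NumberTheory.GaloisRepresentations
  Literature.NumberTheory.EllipticCurves.Rank1Residual Summit.BirchSwinnertonDyer.Rank1Residual.Supersingular
  Summit.BirchSwinnertonDyer.Rank1Residual.X4

namespace Summit.BirchSwinnertonDyer.BirchSwinnertonDyer.Theorems.KuriharaRigidity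

/-- **Crux `KobayashiLowerHalfLargeImage` BY NAME, `p = 3` road included, on PACKAGE-LEVEL named inputs only** (the
lead gen 2's `kobayashiLowerHalfLargeImage_of_readings_of_kks_OPEN` with its three composite binders fed from the
finer statements): GRANTED Kim 2026 Thm 1.11 on the `η = 1` package (`hKim`, PUBLISHED), Castella–Sano Thm 1
(i) ⟹ (ii) on the package (`hCS`, PREPRINT claim), the CS §2 `≥` reading (`hCSge`, PREPRINT reading), KKS Thm 1.1 at
`3` on the package (`hKKS3`, claim-grade at `3`), Kobayashi Thm 1.2 (`h12`), the period facts (`h5`, `h3`) — and the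
line's three OPEN statements displayed (`hLe`: the `≤` half of Kim's [C] 1.10 on X7 ∧ ¬CM ∧ Surj ∧ `p ≥ 5`; `hU`:
Kurihara's [C] at `3` on X7@3 ∧ ¬CM ∧ Surj ∧ (Tam)₁ ∧ `3 ∤ ∏ c_ℓ`; `hR`: the crux at the remaining X7@3 pairs) — the
crux holds. CONDITIONAL; closes nothing; BSD is not proved by any of this.
[cite: Kim2022StructureSelmer, Thm. 1.11 (1) ⟹ (3) (PDF p. 8)] [claim: CastellaSano2026, status: under-review]
[claim: Kim2025RefinedTNC, status: under-review] [cite: KimKimSun2020, Thm. 1.1 (p. 4)]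
[cite: Kobayashi2003, Thm. 1.2 (p. 2), Thm. 7.4 (p. 13)] [cite: GreenbergVatsal2000, §3, Remark 3.4] -/
theorem kobayashiLowerHalfLargeImage_of_packageFacts_with_three_OPEN
    (hKim : Kim2026.thm111_katoMainIdentity_of_kuriharaNumber_ne_zero)
    (hCS : CastellaSano2026.thm1_katoMainIdentity_of_kimTamagawaDefect_OPEN)
    (hCSge : CastellaSano2026_sec2_tamagawaDefectGe_implicit_OPEN)
    (hKKS3 : KimKimSun2020.thm11_katoMainIdentity_of_kuriharaNumber_ne_zero_three_OPEN)
    (h12 : Kobayashi2003.thm12_signedSelmerDual_finite_torsion)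
    (h5 : realPeriodRat_eq_unit_mul_plusPeriod) (h3 : realPeriodRat_eq_unit_mul_plusPeriod_three)
    (hLe : ∀ (W : WeierstrassCurve ℚ) [W.IsElliptic] [W.IsGloballyMinimal] (p : ℕ) [Fact p.Prime],
      5 ≤ p → ClassX7 W p → ¬ W.HasCM → W.frobeniusTrace p = 0 → Surj W p →
      ∀ [NeZero (W.conductorNorm ℤ)] (f : CuspForm (Gamma0 (W.conductorNorm ℤ)) 2),
        IsNewformOf W f → KimTamagawaDefectLeAt W p f)
    (hU : ∀ (W : WeierstrassCurve ℚ) [W.IsElliptic] [W.IsGloballyMinimal] (p : ℕ) [Fact p.Prime],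
      p = 3 → ClassX7 W p → ¬ W.HasCM → W.frobeniusTrace p = 0 → Surj W p → KimKimSun2020TamAt W p →
      ¬ p ∣ W.tamagawaProduct →
      ∀ [NeZero (W.conductorNorm ℤ)] (f : CuspForm (Gamma0 (W.conductorNorm ℤ)) 2),
        IsNewformOf W f → KuriharaUnitAt W p f)
    (hR : ∀ (W : WeierstrassCurve ℚ) [W.IsElliptic] [W.IsGloballyMinimal] (p : ℕ) [Fact p.Prime],
      p = 3 → ClassX7 W p → ¬ W.HasCM → W.frobeniusTrace p = 0 → Surj W p →
      ¬ (KimKimSun2020TamAt W p ∧ ¬ p ∣ W.tamagawaProduct) →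
      ∃ ε : ℤˣ, KobayashiLowerDivisibility W p ε) :
    Summit.BirchSwinnertonDyer.BirchSwinnertonDyer.Theses.SignedLowerHalves.KobayashiLowerHalfLargeImage :=
  kobayashiLowerHalfLargeImage_of_readings_of_kks_OPEN (kim2026_thm111_via_kobayashi74_of_facts hKim h12 h5)
    (castellaSano2026_thm1_via_kobayashi74_OPEN_of_facts hCS h12 h5) hCSge h5
    (kimKimSun2020_thm11_via_kobayashi74_three_of_facts hKKS3 h12 h5 h3) h3 hLe hU hR

end Summit.BirchSwinnertonDyer.BirchSwinnertonDyer.Theorems.KuriharaRigidity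

end
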